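import Summits.CriticalPhenomena.PercolationContinuityZ3.Theorems.SahiAECornerEnvelopeProduct
import Summits.CriticalPhenomena.PercolationContinuityZ3.Theorems.SahiAESeparableTiltCoord
import Summits.CriticalPhenomena.PercolationContinuityZ3.Theorems.SahiAEBoxExtensionCoord

/-!
# The structure theorem in every dimension, orthant step: a supermodular version above a generic base point

Support file of the Sahi cell (`prim-sahi`, typer seat, generation 23; `--supports stmt-CriticalPhenomena-4575`).
Three small definitions (`axisSum`, `orthantDensity`, `orthantVersion`), theorems otherwise; no named facts, no sorries.

Let `φ : ℝ^ι → ℝ` (`ι` finite) be measurable and supermodular on Lebesgue-almost every pair,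
`φ(x) + φ(y) ≤ φ(x ∧ y) + φ(x ∨ y)`; NO boundedness or integrability is assumed.  For a base point `c` put

  `S_c(x) = Σᵢ φ(c; i := xᵢ) − (|ι| − 1) φ(c)`     (`axisSum`, the sum of the axis sections through `c`),

a MODULAR function (`S_c(x) + S_c(y) = S_c(x ∧ y) + S_c(x ∨ y)` identically, `axisSum_modular`).  For Lebesgue-almost
every `c` (`ae_generic_base`: the a.e. hypothesis pulled back along the quasi-measure-preserving map
`(c, x, s) ↦ (c; i := s, x)`), supermodularity at the generic pairs `(c; i := s, x)` — whose meet and join are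
`(c; i := xᵢ)` and `(x; i := s)` when `x > c` and `s ≥ xᵢ` — says exactly that `G_c = φ − S_c` is non-decreasing in
each coordinate on the open orthant `O_c = {x > c}`, for almost every `(x, s)`; by the coordinate gluings of
`SahiAESeparableTiltCoord.lean` it is non-decreasing on almost every comparable pair.  Hence the density
`g_c = 𝟙_{O_c} · exp G_c` (`orthantDensity`) is a.e.-MTP₂, a.e.-monotone and locally essentially bounded (a.e.
monotonicity bounds it below every point by its value at a generic larger point — this is where boundedness became
unnecessary), and its lower-corner envelope `F_c = cornerEnvelope g_c` (`SahiAECornerEnvelopeExplicit.lean`) is a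
Borel version, MTP₂ and monotone at every pair, finite, and positive on `O_c`.  The function

  `ψ_c = log F_c + S_c`     (`orthantVersion`)

is then Borel, `= φ` a.e. on `O_c`, and supermodular at EVERY pair of `O_c` (`orthantVersion_spec`);
`SahiAEOrthantGluing.lean` glues these versions along base points `c_k ↓ −∞`.  No sorries, no new axioms.
-/

noncomputable section

namespace Summit.CriticalPhenomena.PercolationContinuityZ3.Theorems.SahiAEFourFunctions

open MeasureTheory Set Filter Topology Function
open Summit.CriticalPhenomena.PercolationContinuityZ3.Theorems.SahiAESeparableTilt
open scoped ENNReal NNReal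

variable {ι : Type*} [Fintype ι] [DecidableEq ι]

/-! ### The axis sum through a base point -/

/-- **The axis sum** `S_c(x) = Σᵢ φ(update c i xᵢ) − (|ι| − 1) φ(c)`: the modular function built from the sections
of `φ` along the coordinate axes through `c`. [this work] -/
def axisSum (φ : (ι → ℝ) → ℝ) (c x : ι → ℝ) : ℝ :=
  ∑ i, φ (update c i (x i)) - ((Fintype.card ι : ℝ) - 1) * φ c

/-- The axis sum is measurable in `x`. [folklore] -/
theorem measurable_axisSum {φ : (ι → ℝ) → ℝ} (hφ : Measurable φ) (c : ι → ℝ) : Measurable (axisSum φ c) := by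
  unfold axisSum
  refine (Finset.measurable_sum _ fun i _ => ?_).sub measurable_const
  exact hφ.comp ((measurable_update c).comp (measurable_pi_apply i))

/-- **The axis sum is modular**: `S_c(x) + S_c(y) = S_c(x ∧ y) + S_c(x ∨ y)` for all `x, y`. [folklore] -/
theorem axisSum_modular (φ : (ι → ℝ) → ℝ) (c x y : ι → ℝ) :
    axisSum φ c x + axisSum φ c y = axisSum φ c (x ⊓ y) + axisSum φ c (x ⊔ y) := by
  unfold axisSum
  have h : ∀ i, φ (update c i (x i)) + φ (update c i (y i)) =
      φ (update c i ((x ⊓ y) i)) + φ (update c i ((x ⊔ y) i)) := fun i => by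
    simp only [Pi.inf_apply, Pi.sup_apply]
    exact (apply_min_add_apply_max (fun t => φ (update c i t)) (x i) (y i)).symm
  have hs : ∑ i, φ (update c i (x i)) + ∑ i, φ (update c i (y i)) =
      ∑ i, φ (update c i ((x ⊓ y) i)) + ∑ i, φ (update c i ((x ⊔ y) i)) := by
    rw [← Finset.sum_add_distrib, ← Finset.sum_add_distrib]
    exact Finset.sum_congr rfl fun i _ => h i
  linarith

/-- The increment of the axis sum along coordinate `i` is the increment of the `i`-th axis section. [folklore] -/
theorem axisSum_update_sub (φ : (ι → ℝ) → ℝ) (c x : ι → ℝ) (i : ι) (s : ℝ) :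
    axisSum φ c (update x i s) - axisSum φ c x = φ (update c i s) - φ (update c i (x i)) := by
  unfold axisSum
  rw [sub_sub_sub_cancel_right, ← Finset.sum_sub_distrib,
    Finset.sum_eq_single_of_mem i (Finset.mem_univ i) fun j _ hj => by rw [update_of_ne hj, sub_self]]
  rw [update_self]

omit [Fintype ι] in
/-- Meet with an updated smaller base point: `(c; i := s) ∧ x = (c; i := xᵢ)` for `c < x`, `xᵢ ≤ s`. [folklore] -/
theorem update_inf_eq_update {c x : ι → ℝ} (hcx : ∀ j, c j < x j) {i : ι} {s : ℝ} (hs : x i ≤ s) :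
    update c i s ⊓ x = update c i (x i) := by
  funext j
  by_cases hj : j = i
  · subst hj; simp [hs]
  · simp [update_of_ne hj, (hcx j).le]

omit [Fintype ι] in
/-- Join with an updated smaller base point: `(c; i := s) ∨ x = (x; i := s)` for `c < x`, `xᵢ ≤ s`. [folklore] -/
theorem update_sup_eq_update {c x : ι → ℝ} (hcx : ∀ j, c j < x j) {i : ι} {s : ℝ} (hs : x i ≤ s) :
    update c i s ⊔ x = update x i s := by
  funext j
  by_cases hj : j = i
  · subst hj; simp [hs]
  · simp [update_of_ne hj, (hcx j).le]

/-! ### Generic base points -/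

/-- **Almost every base point is generic**: for Lebesgue-almost every `c`, every coordinate `i`, and almost every
`(x, s)`, the pair `((c; i := s), x)` satisfies the supermodular inequality (pull-back of the a.e. hypothesis along
the quasi-measure-preserving map `(c, (x, s)) ↦ ((c; i := s), x)`). [this work] -/
theorem ae_generic_base {φ : (ι → ℝ) → ℝ}
    (hsm : ∀ᵐ p ∂(volume : Measure (ι → ℝ)).prod volume, φ p.1 + φ p.2 ≤ φ (p.1 ⊓ p.2) + φ (p.1 ⊔ p.2)) :
    ∀ᵐ c ∂(volume : Measure (ι → ℝ)), ∀ i, ∀ᵐ q ∂(volume : Measure (ι → ℝ)).prod (volume : Measure ℝ),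
      φ (update c i q.2) + φ q.1 ≤ φ (update c i q.2 ⊓ q.1) + φ (update c i q.2 ⊔ q.1) := by
  rw [ae_all_iff]
  intro i
  -- the shuffle `(c, (x, s)) ↦ ((c, s), x)`
  have hsw : MeasurePreserving (Prod.map id Prod.swap : (ι → ℝ) × ((ι → ℝ) × ℝ) → (ι → ℝ) × (ℝ × (ι → ℝ)))
      ((volume : Measure (ι → ℝ)).prod ((volume : Measure (ι → ℝ)).prod (volume : Measure ℝ)))
      ((volume : Measure (ι → ℝ)).prod ((volume : Measure ℝ).prod (volume : Measure (ι → ℝ)))) :=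
    (MeasurePreserving.id _).prod Measure.measurePreserving_swap
  have has : MeasurePreserving (MeasurableEquiv.prodAssoc : ((ι → ℝ) × ℝ) × (ι → ℝ) ≃ᵐ (ι → ℝ) × (ℝ × (ι → ℝ))).symm
      ((volume : Measure (ι → ℝ)).prod ((volume : Measure ℝ).prod (volume : Measure (ι → ℝ))))
      (((volume : Measure (ι → ℝ)).prod (volume : Measure ℝ)).prod (volume : Measure (ι → ℝ))) :=
    (measurePreserving_prodAssoc (volume : Measure (ι → ℝ)) (volume : Measure ℝ) (volume : Measure (ι → ℝ))).symm _
  have hU : Measure.QuasiMeasurePreserving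
      (Prod.map (fun p : (ι → ℝ) × ℝ => update p.1 i p.2) id : ((ι → ℝ) × ℝ) × (ι → ℝ) → (ι → ℝ) × (ι → ℝ))
      (((volume : Measure (ι → ℝ)).prod (volume : Measure ℝ)).prod (volume : Measure (ι → ℝ)))
      ((volume : Measure (ι → ℝ)).prod volume) :=
    MeasureTheory.QuasiMeasurePreserving.prodMap (quasiMeasurePreserving_update (ι := ι) i)
      (Measure.QuasiMeasurePreserving.id _)
  have hΘ : Measure.QuasiMeasurePreserving
      (fun w : (ι → ℝ) × ((ι → ℝ) × ℝ) => (update w.1 i w.2.2, w.2.1))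
      ((volume : Measure (ι → ℝ)).prod ((volume : Measure (ι → ℝ)).prod (volume : Measure ℝ)))
      ((volume : Measure (ι → ℝ)).prod volume) := by
    have e : (fun w : (ι → ℝ) × ((ι → ℝ) × ℝ) => (update w.1 i w.2.2, w.2.1)) =
        (Prod.map (fun p : (ι → ℝ) × ℝ => update p.1 i p.2) id) ∘
          (MeasurableEquiv.prodAssoc : ((ι → ℝ) × ℝ) × (ι → ℝ) ≃ᵐ (ι → ℝ) × (ℝ × (ι → ℝ))).symm ∘
          (Prod.map id Prod.swap) := by
      funext w; rfl
    rw [e]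
    exact (hU.comp has.quasiMeasurePreserving).comp hsw.quasiMeasurePreserving
  have h1 : ∀ᵐ w ∂(volume : Measure (ι → ℝ)).prod ((volume : Measure (ι → ℝ)).prod (volume : Measure ℝ)),
      φ (update w.1 i w.2.2) + φ w.2.1 ≤ φ (update w.1 i w.2.2 ⊓ w.2.1) + φ (update w.1 i w.2.2 ⊔ w.2.1) := by
    filter_upwards [hΘ.ae hsm] with w hw
    exact hw
  exact Measure.ae_ae_of_ae_prod (p := fun w : (ι → ℝ) × ((ι → ℝ) × ℝ) =>
    φ (update w.1 i w.2.2) + φ w.2.1 ≤ φ (update w.1 i w.2.2 ⊓ w.2.1) + φ (update w.1 i w.2.2 ⊔ w.2.1)) h1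

/-! ### The orthant density and its envelope -/

/-- **The orthant density** `g_c = 𝟙_{O_c} · exp(φ − S_c)`, `O_c = {x | ∀ i, cᵢ < xᵢ}`. [this work] -/
def orthantDensity (φ : (ι → ℝ) → ℝ) (c : ι → ℝ) : (ι → ℝ) → ℝ≥0∞ := fun x =>
  ENNReal.ofReal ((Set.pi univ fun i => Ioi (c i)).indicator (fun x => Real.exp (φ x - axisSum φ c x)) x)

omit [Fintype ι] [DecidableEq ι] in
/-- Membership in the open orthant. [folklore] -/
theorem mem_orthant_iff {c x : ι → ℝ} : x ∈ (Set.pi univ fun i => Ioi (c i)) ↔ ∀ i, c i < x i := by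
  simp only [Set.mem_univ_pi, Set.mem_Ioi]

omit [Fintype ι] [DecidableEq ι] in
/-- The open orthant is measurable. [folklore] -/
theorem measurableSet_orthant (c : ι → ℝ) [Countable ι] : MeasurableSet (Set.pi univ fun i => Ioi (c i)) :=
  MeasurableSet.univ_pi fun _ => measurableSet_Ioi

omit [Fintype ι] [DecidableEq ι] in
/-- The open orthant is a sublattice: meets. [folklore] -/
theorem inf_mem_orthant {c x y : ι → ℝ} (hx : x ∈ Set.pi univ fun i => Ioi (c i))
    (hy : y ∈ Set.pi univ fun i => Ioi (c i)) : x ⊓ y ∈ Set.pi univ fun i => Ioi (c i) := by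
  rw [mem_orthant_iff] at hx hy ⊢
  exact fun i => lt_min (hx i) (hy i)

omit [Fintype ι] [DecidableEq ι] in
/-- The open orthant is a sublattice: joins. [folklore] -/
theorem sup_mem_orthant {c x : ι → ℝ} (hx : x ∈ Set.pi univ fun i => Ioi (c i))
    (y : ι → ℝ) : x ⊔ y ∈ Set.pi univ fun i => Ioi (c i) :=
  mem_orthant_iff.2 fun i => (mem_orthant_iff.1 hx i).trans_le (le_max_left _ _)

omit [Fintype ι] [DecidableEq ι] in
/-- The open orthant is an up-set. [folklore] -/
theorem mem_orthant_of_le {c x y : ι → ℝ} (hx : x ∈ Set.pi univ fun i => Ioi (c i)) (hxy : x ≤ y) :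
    y ∈ Set.pi univ fun i => Ioi (c i) :=
  mem_orthant_iff.2 fun i => (mem_orthant_iff.1 hx i).trans_le (hxy i)

omit [Fintype ι] [DecidableEq ι] in
/-- Nested orthants. [folklore] -/
theorem orthant_subset_orthant {c c' : ι → ℝ} (h : c' ≤ c) :
    (Set.pi univ fun i => Ioi (c i)) ⊆ Set.pi univ fun i => Ioi (c' i) := fun x hx => by
  rw [mem_orthant_iff] at hx ⊢
  exact fun i => (h i).trans_lt (hx i)

/-- The orthant density on the orthant. [folklore] -/
theorem orthantDensity_of_mem {φ : (ι → ℝ) → ℝ} {c x : ι → ℝ} (hx : x ∈ Set.pi univ fun i => Ioi (c i)) :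
    orthantDensity φ c x = ENNReal.ofReal (Real.exp (φ x - axisSum φ c x)) := by
  simp only [orthantDensity, Set.indicator_of_mem hx]

/-- The orthant density off the orthant. [folklore] -/
theorem orthantDensity_of_not_mem {φ : (ι → ℝ) → ℝ} {c x : ι → ℝ} (hx : x ∉ Set.pi univ fun i => Ioi (c i)) :
    orthantDensity φ c x = 0 := by
  simp only [orthantDensity, Set.indicator_of_notMem hx, ENNReal.ofReal_zero]

/-- The orthant density is finite. [folklore] -/
theorem orthantDensity_ne_top (φ : (ι → ℝ) → ℝ) (c x : ι → ℝ) : orthantDensity φ c x ≠ ∞ := ENNReal.ofReal_ne_top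

/-- The orthant density is non-zero exactly on the orthant. [folklore] -/
theorem orthantDensity_ne_zero {φ : (ι → ℝ) → ℝ} {c x : ι → ℝ} (hx : x ∈ Set.pi univ fun i => Ioi (c i)) :
    orthantDensity φ c x ≠ 0 := by
  rw [orthantDensity_of_mem hx]
  exact (ENNReal.ofReal_pos.2 (Real.exp_pos _)).ne'

/-- The orthant density is measurable. [folklore] -/
theorem measurable_orthantDensity {φ : (ι → ℝ) → ℝ} (hφ : Measurable φ) (c : ι → ℝ) :
    Measurable (orthantDensity φ c) :=
  ENNReal.measurable_ofReal.comp
    ((Real.measurable_exp.comp (hφ.sub (measurable_axisSum hφ c))).indicator (measurableSet_orthant c))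

/-- **The orthant density is MTP₂ on almost every pair** (the axis sum is modular). [this work] -/
theorem ae_mtp2_orthantDensity {φ : (ι → ℝ) → ℝ}
    (hsm : ∀ᵐ p ∂(volume : Measure (ι → ℝ)).prod volume, φ p.1 + φ p.2 ≤ φ (p.1 ⊓ p.2) + φ (p.1 ⊔ p.2))
    (c : ι → ℝ) :
    ∀ᵐ p ∂(volume : Measure (ι → ℝ)).prod volume, orthantDensity φ c p.1 * orthantDensity φ c p.2 ≤
      orthantDensity φ c (p.1 ⊓ p.2) * orthantDensity φ c (p.1 ⊔ p.2) := by
  filter_upwards [hsm] with p hp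
  by_cases hx : p.1 ∈ Set.pi univ fun i => Ioi (c i)
  · by_cases hy : p.2 ∈ Set.pi univ fun i => Ioi (c i)
    · rw [orthantDensity_of_mem hx, orthantDensity_of_mem hy, orthantDensity_of_mem (inf_mem_orthant hx hy),
        orthantDensity_of_mem (sup_mem_orthant hx p.2), ← ENNReal.ofReal_mul (Real.exp_pos _).le,
        ← ENNReal.ofReal_mul (Real.exp_pos _).le, ← Real.exp_add, ← Real.exp_add]
      refine ENNReal.ofReal_le_ofReal (Real.exp_le_exp.2 ?_)
      linarith [axisSum_modular φ c p.1 p.2]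
    · rw [orthantDensity_of_not_mem hy, mul_zero]; exact zero_le
  · rw [orthantDensity_of_not_mem hx, zero_mul]; exact zero_le

/-- **Above a generic base point the orthant density is non-decreasing on almost every comparable pair.**  The
coordinatewise statement is supermodularity at the generic pairs `((c; i := s), x)`; the globalisation is
`ae_monotone_of_ae_coord_monotone`. [this work] -/
theorem ae_monotone_orthantDensity {φ : (ι → ℝ) → ℝ} {c : ι → ℝ}
    (hc : ∀ i, ∀ᵐ q ∂(volume : Measure (ι → ℝ)).prod (volume : Measure ℝ),
      φ (update c i q.2) + φ q.1 ≤ φ (update c i q.2 ⊓ q.1) + φ (update c i q.2 ⊔ q.1)) :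
    ∀ᵐ p ∂(volume : Measure (ι → ℝ)).prod volume,
      p.1 ≤ p.2 → orthantDensity φ c p.1 ≤ orthantDensity φ c p.2 := by
  set O : Set (ι → ℝ) := Set.pi univ fun i => Ioi (c i) with hO
  set G : (ι → ℝ) → ℝ := O.indicator fun x => Real.exp (φ x - axisSum φ c x) with hG
  have hG0 : ∀ x, 0 ≤ G x := fun x => Set.indicator_nonneg (fun y _ => (Real.exp_pos _).le) x
  have hcoord : ∀ i, ∀ᵐ q ∂(volume : Measure (ι → ℝ)).prod (volume : Measure ℝ),
      q.1 i ≤ q.2 → G q.1 ≤ G (update q.1 i q.2) := by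
    intro i
    filter_upwards [hc i] with q hq hle
    by_cases hx : q.1 ∈ O
    · have hcx : ∀ j, c j < q.1 j := mem_orthant_iff.1 hx
      have hx' : update q.1 i q.2 ∈ O := by
        refine mem_orthant_iff.2 fun j => ?_
        by_cases hj : j = i
        · subst hj; rw [update_self]; exact (hcx j).trans_le hle
        · rw [update_of_ne hj]; exact hcx j
      rw [update_inf_eq_update hcx hle, update_sup_eq_update hcx hle] at hq
      rw [hG, Set.indicator_of_mem hx, Set.indicator_of_mem hx']
      refine Real.exp_le_exp.2 ?_
      have hS := axisSum_update_sub φ c q.1 i q.2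
      linarith
    · rw [hG, Set.indicator_of_notMem hx]
      exact hG0 _
  have hmono := ae_monotone_of_ae_coord_monotone (G := G) hcoord
  filter_upwards [hmono] with p hp hle
  exact ENNReal.ofReal_le_ofReal (hp hle)

omit [DecidableEq ι] in
/-- **An a.e.-monotone finite density is locally essentially bounded below every point** (by its value at a generic
larger point). [this work] -/
theorem local_bound_of_ae_monotone {g : (ι → ℝ) → ℝ≥0∞} (hT : ∀ x, g x ≠ ∞)
    (hmono : ∀ᵐ p ∂(volume : Measure (ι → ℝ)).prod volume, p.1 ≤ p.2 → g p.1 ≤ g p.2) (q : ι → ℝ) :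
    ∃ M : ℝ≥0∞, M ≠ ∞ ∧ ∀ᵐ z ∂(volume : Measure (ι → ℝ)), z ≤ q → g z ≤ M := by
  have hmono2 : ∀ᵐ y ∂(volume : Measure (ι → ℝ)), ∀ᵐ x ∂(volume : Measure (ι → ℝ)), x ≤ y → g x ≤ g y := by
    have hsw := (Measure.measurePreserving_swap (μ := (volume : Measure (ι → ℝ)))
      (ν := (volume : Measure (ι → ℝ)))).quasiMeasurePreserving.ae hmono
    exact Measure.ae_ae_of_ae_prod (p := fun z : (ι → ℝ) × (ι → ℝ) => z.2 ≤ z.1 → g z.2 ≤ g z.1) hsw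
  set B : Set (ι → ℝ) := Set.pi univ fun i => Ioc (q i + 1 - 1) (q i + 1) with hB
  have hB0 : volume B ≠ 0 := by
    rw [hB, volume_lowerCorner]; simp
  have hBq : ∀ y ∈ B, q ≤ y := fun y hy i => by
    have := (Set.mem_univ_pi.1 hy i).1; linarith
  obtain ⟨y, hyB, hy⟩ : ∃ y ∈ B, ∀ᵐ x ∂(volume : Measure (ι → ℝ)), x ≤ y → g x ≤ g y := by
    by_contra hne
    apply hB0
    refine measure_mono_null (fun y hy => ?_) (ae_iff.1 hmono2)
    exact fun hy' => hne ⟨y, hy, hy'⟩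
  refine ⟨g y, hT y, ?_⟩
  filter_upwards [hy] with z hz hzq
  exact hz (hzq.trans (hBq y hyB))

omit [DecidableEq ι] in
/-- **Positivity of the envelope of an a.e.-monotone density**: if `g ≠ 0` on a set of positive measure below `p`
then `cornerEnvelope g p ≠ 0` (the envelope is monotone and agrees with `g` at a generic point of the set).
[this work] -/
theorem cornerEnvelope_ne_zero_of_ae_monotone {g : (ι → ℝ) → ℝ≥0∞} (hg : Measurable g)
    (hmono : ∀ᵐ p ∂(volume : Measure (ι → ℝ)).prod volume, p.1 ≤ p.2 → g p.1 ≤ g p.2) {p : ι → ℝ}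
    {B : Set (ι → ℝ)} (hB0 : volume B ≠ 0) (hBp : ∀ z ∈ B, z ≤ p) (hgB : ∀ z ∈ B, g z ≠ 0) :
    cornerEnvelope g p ≠ 0 := by
  obtain ⟨z, hzB, hzF⟩ : ∃ z ∈ B, cornerEnvelope g z = g z := by
    by_contra hne
    apply hB0
    refine measure_mono_null (fun z hz => ?_) (ae_iff.1 (cornerEnvelope_ae_eq hg hmono))
    exact fun h => hne ⟨z, hz, h⟩
  intro h0
  have hle : cornerEnvelope g z ≤ cornerEnvelope g p := cornerEnvelope_mono hg hmono (hBp z hzB)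
  rw [h0, hzF, nonpos_iff_eq_zero] at hle
  exact hgB z hzB hle

omit [DecidableEq ι] in
/-- The unit corner box below `p` witnesses positivity everywhere for an everywhere non-zero density.
[folklore] -/
theorem cornerEnvelope_ne_zero_of_ae_monotone' {g : (ι → ℝ) → ℝ≥0∞} (hg : Measurable g)
    (hmono : ∀ᵐ p ∂(volume : Measure (ι → ℝ)).prod volume, p.1 ≤ p.2 → g p.1 ≤ g p.2) (h0 : ∀ x, g x ≠ 0)
    (p : ι → ℝ) : cornerEnvelope g p ≠ 0 := by
  refine cornerEnvelope_ne_zero_of_ae_monotone hg hmono (B := Set.pi univ fun i => Ioc (p i - 1) (p i)) ?_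
    (fun z hz => le_of_mem_lowerCorner hz) (fun z _ => h0 z)
  rw [volume_lowerCorner]; simp

/-- **The orthant density is locally essentially bounded below every point.** [this work] -/
theorem local_bound_orthantDensity {φ : (ι → ℝ) → ℝ} {c : ι → ℝ}
    (hmono : ∀ᵐ p ∂(volume : Measure (ι → ℝ)).prod volume,
      p.1 ≤ p.2 → orthantDensity φ c p.1 ≤ orthantDensity φ c p.2) (q : ι → ℝ) :
    ∃ M : ℝ≥0∞, M ≠ ∞ ∧ ∀ᵐ z ∂(volume : Measure (ι → ℝ)), z ≤ q → orthantDensity φ c z ≤ M :=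
  local_bound_of_ae_monotone (orthantDensity_ne_top φ c) hmono q

/-- The corner essential suprema of the orthant density above a generic base point are finite. [this work] -/
theorem cornerEssSup_orthantDensity_ne_top {φ : (ι → ℝ) → ℝ} {c : ι → ℝ}
    (hmono : ∀ᵐ p ∂(volume : Measure (ι → ℝ)).prod volume,
      p.1 ≤ p.2 → orthantDensity φ c p.1 ≤ orthantDensity φ c p.2) (n : ℕ) (p : ι → ℝ) :
    cornerEssSup (orthantDensity φ c) n p ≠ ∞ :=
  cornerEssSup_ne_top_of_local (local_bound_orthantDensity hmono) n p

/-- **The envelope of the orthant density above a generic base point**: Borel, finite, `= g_c` a.e., MTP₂ at every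
pair, monotone at every comparable pair. [this work] -/
theorem cornerEnvelope_orthantDensity_spec {φ : (ι → ℝ) → ℝ} (hφ : Measurable φ)
    (hsm : ∀ᵐ p ∂(volume : Measure (ι → ℝ)).prod volume, φ p.1 + φ p.2 ≤ φ (p.1 ⊓ p.2) + φ (p.1 ⊔ p.2))
    {c : ι → ℝ}
    (hc : ∀ i, ∀ᵐ q ∂(volume : Measure (ι → ℝ)).prod (volume : Measure ℝ),
      φ (update c i q.2) + φ q.1 ≤ φ (update c i q.2 ⊓ q.1) + φ (update c i q.2 ⊔ q.1)) :
    Measurable (cornerEnvelope (orthantDensity φ c)) ∧ (∀ x, cornerEnvelope (orthantDensity φ c) x ≠ ∞) ∧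
      cornerEnvelope (orthantDensity φ c) =ᵐ[volume] orthantDensity φ c ∧
      (∀ x y, cornerEnvelope (orthantDensity φ c) x * cornerEnvelope (orthantDensity φ c) y ≤
        cornerEnvelope (orthantDensity φ c) (x ⊓ y) * cornerEnvelope (orthantDensity φ c) (x ⊔ y)) ∧
      Monotone (cornerEnvelope (orthantDensity φ c)) :=
  cornerEnvelope_spec_local (measurable_orthantDensity hφ c)
    (local_bound_orthantDensity (ae_monotone_orthantDensity hc)) (ae_mtp2_orthantDensity hsm c)
    (ae_monotone_orthantDensity hc)

/-- **The envelope is positive on the open orthant** (it dominates the density at a generic smaller point of the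
orthant, where the density is an exponential). [this work] -/
theorem cornerEnvelope_orthantDensity_ne_zero {φ : (ι → ℝ) → ℝ} (hφ : Measurable φ) {c : ι → ℝ}
    (hc : ∀ i, ∀ᵐ q ∂(volume : Measure (ι → ℝ)).prod (volume : Measure ℝ),
      φ (update c i q.2) + φ q.1 ≤ φ (update c i q.2 ⊓ q.1) + φ (update c i q.2 ⊔ q.1))
    {p : ι → ℝ} (hp : p ∈ Set.pi univ fun i => Ioi (c i)) :
    cornerEnvelope (orthantDensity φ c) p ≠ 0 := by
  refine cornerEnvelope_ne_zero_of_ae_monotone (measurable_orthantDensity hφ c) (ae_monotone_orthantDensity hc)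
    (B := Set.pi univ fun i => Ioc (c i) (p i)) ?_ (fun z hz i => (Set.mem_univ_pi.1 hz i).2)
    (fun z hz => orthantDensity_ne_zero (mem_orthant_iff.2 fun i => (Set.mem_univ_pi.1 hz i).1))
  rw [Real.volume_pi_Ioc]
  refine Finset.prod_ne_zero_iff.2 fun i _ => (ENNReal.ofReal_pos.2 ?_).ne'
  have := mem_orthant_iff.1 hp i; linarith

/-! ### The orthant version -/

/-- **The orthant version** `ψ_c = log F_c + S_c`, `F_c` the envelope of the orthant density. [this work] -/
def orthantVersion (φ : (ι → ℝ) → ℝ) (c : ι → ℝ) : (ι → ℝ) → ℝ := fun x =>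
  Real.log (cornerEnvelope (orthantDensity φ c) x).toReal + axisSum φ c x

/-- The orthant version is measurable. [folklore] -/
theorem measurable_orthantVersion {φ : (ι → ℝ) → ℝ} (hφ : Measurable φ) (c : ι → ℝ) :
    Measurable (orthantVersion φ c) :=
  (Real.measurable_log.comp (ENNReal.measurable_toReal.comp
    (measurable_cornerEnvelope (measurable_orthantDensity hφ c)))).add (measurable_axisSum hφ c)

/-- **The orthant version above a generic base point**: `ψ_c = φ` almost everywhere on the open orthant `O_c`, and
`ψ_c(x) + ψ_c(y) ≤ ψ_c(x ∧ y) + ψ_c(x ∨ y)` for ALL `x, y ∈ O_c`. [this work] -/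
theorem orthantVersion_spec {φ : (ι → ℝ) → ℝ} (hφ : Measurable φ)
    (hsm : ∀ᵐ p ∂(volume : Measure (ι → ℝ)).prod volume, φ p.1 + φ p.2 ≤ φ (p.1 ⊓ p.2) + φ (p.1 ⊔ p.2))
    {c : ι → ℝ}
    (hc : ∀ i, ∀ᵐ q ∂(volume : Measure (ι → ℝ)).prod (volume : Measure ℝ),
      φ (update c i q.2) + φ q.1 ≤ φ (update c i q.2 ⊓ q.1) + φ (update c i q.2 ⊔ q.1)) :
    (∀ᵐ x ∂(volume : Measure (ι → ℝ)), x ∈ (Set.pi univ fun i => Ioi (c i)) → orthantVersion φ c x = φ x) ∧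
      ∀ x ∈ (Set.pi univ fun i => Ioi (c i)), ∀ y ∈ (Set.pi univ fun i => Ioi (c i)),
        orthantVersion φ c x + orthantVersion φ c y ≤ orthantVersion φ c (x ⊓ y) + orthantVersion φ c (x ⊔ y) := by
  obtain ⟨-, hFT, hFg, hFmtp, -⟩ := cornerEnvelope_orthantDensity_spec hφ hsm hc
  set F := cornerEnvelope (orthantDensity φ c) with hF
  have hFpos : ∀ x ∈ (Set.pi univ fun i => Ioi (c i)), 0 < (F x).toReal := fun x hx =>
    ENNReal.toReal_pos (cornerEnvelope_orthantDensity_ne_zero hφ hc hx) (hFT x)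
  refine ⟨?_, fun x hx y hy => ?_⟩
  · filter_upwards [hFg] with x hx hxO
    simp only [orthantVersion]
    rw [← hF, hx, orthantDensity_of_mem hxO, ENNReal.toReal_ofReal (Real.exp_pos _).le, Real.log_exp]
    ring
  · have hxy : x ⊓ y ∈ Set.pi univ fun i => Ioi (c i) := inf_mem_orthant hx hy
    have hxy' : x ⊔ y ∈ Set.pi univ fun i => Ioi (c i) := sup_mem_orthant hx y
    have h := hFmtp x y
    have hL : (F x * F y).toReal ≤ (F (x ⊓ y) * F (x ⊔ y)).toReal :=
      ENNReal.toReal_mono (ENNReal.mul_ne_top (hFT _) (hFT _)) h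
    rw [ENNReal.toReal_mul, ENNReal.toReal_mul] at hL
    have hlog : Real.log (F x).toReal + Real.log (F y).toReal ≤
        Real.log (F (x ⊓ y)).toReal + Real.log (F (x ⊔ y)).toReal := by
      rw [← Real.log_mul (hFpos x hx).ne' (hFpos y hy).ne',
        ← Real.log_mul (hFpos _ hxy).ne' (hFpos _ hxy').ne']
      exact Real.log_le_log (mul_pos (hFpos x hx) (hFpos y hy)) hL
    simp only [orthantVersion]
    linarith [axisSum_modular φ c x y]

end Summit.CriticalPhenomena.PercolationContinuityZ3.Theorems.SahiAEFourFunctions
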